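import Literature.IUT.HodgeArakelov.ThetaEvaluationModelEvInstance
import Literature.IUT.HodgeArakelov.ThetaEvaluationModelEvRetraction
import Literature.IUT.HodgeArakelov.ThetaEvaluationModelEvKummer
import Literature.IUT.HodgeArakelov.CohomologyAutKummer
import Literature.IUT.HodgeArakelov.EtaleThetaDataOfSettingInversion
import Literature.IUT.HodgeArakelov.EtaleThetaDataOfSettingGaloisUnits
import Literature.IUT.HodgeArakelov.IotaInvariantThetaInftyModel
import Literature.IUT.HodgeArakelov.ConstantMultipleRigidityProofs2

/-!
# [IUTchII] Cor 1.12 (ii) AT THE MODEL `Π := Π^tp_{X̲̲}` — proof companion of the model theta-evaluation datum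

Proof-only companion (abc-iut cell, D-0067 wave 4, seat abc-iut-w4-d043 gen 2; L6-lead ruling §F v1.18c (1); SUBDAG
`plan/L6/SUBDAG-IUTchII-Cor-112.md` row Cor-112.ii.r13; node **IUTchII:Cor1.12(ii)**) to `ThetaEvaluationModelEv.lean`
/ `ThetaEvaluationModelEvRetraction.lean` / `ThetaEvaluationModelEvInstance.lean` (the model instance
`EtaleLevels.thetaEvaluation` of abc-iut-L6-t1's `ThetaEvaluation`) and to `ConstantMultipleRigidityProofs(2).lean`
(Cor. 1.12 (ii) from its printed inputs). No definitions.

S. Mochizuki, *Inter-universal Teichmüller theory II*, kurims manuscript (Dec. 2020), Cor. 1.12 (ii) p. 57; proof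
p. 58 ("Assertion (ii) follows immediately from the structure of the objects under consideration, as described in
[EtTh], Proposition 1.5, (ii), (iii)"); [EtTh] §1 p. 12 (`Δ_Θ` central in `Δ^Θ_X`). Claim key `Mochizuki2012`
(D-0012, DISPUTED); nothing here takes a side on [IUTchIII] Cor. 3.12.

PROVED:
* `EtaleLevels.aug_ker_acts_trivially` — the input `hN` of `LevelRetraction.ofAugmentation` AT THE MODEL: the kernel
  of the augmentation `Π^tp_{X̲̲} → G_{ℚ_p}` (i.e. `Δ^tp_{X̲̲}`) acts trivially on the coefficients `(l·Δ_Θ)`, from L2's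
  root axiom `ThetaSetting.ker_thetaToEll_central` ("`Δ^Θ_X` is a central extension", [EtTh] p. 12);
  `EtaleLevels.continuous_augHuu` — the input `hq` (continuity of the augmentation on `Π^tp_{X̲̲}`);
* **`EtaleLevels.cor112_ii_thetaEvaluation`** — **[IUTchII] Cor. 1.12 (ii) for the MODEL datum**
  `EtaleLevels.thetaEvaluation …`: the typed `Cor112_ii` HOLDS given exactly (a) `hι` — `ι` fixes the Kummer classes of
  the units up to torsion (Rmk. 1.4.1 (ii): `ι_Ÿ` lies over `k`), (b) `hμ` — the torsion of
  `lim_K H¹(D_{μ_-}|_K, (l·Δ_Θ))` consists of Kummer classes of units (`μ(k̄) ⊆ O^×`; Kummer theory of MLF, FACT-level,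
  BY NAME), (c) the [IUTchII] Prop. 2.2 (ii) translate inputs `τ` (centred at the standard class `I.etaStd`), `hdesc`,
  `hrev`, `hfree` (residual (R1)–(R3) of GAP row G-w4d010-2, shared with abc-iut-w4-d010's `prop22_ii'_model`), and
  (d) `hres` — torsion-compatibility of the pointed inversion's `resDmu` with restriction to `D_{μ_-}` on the limit;
  the unit-class inputs `(hD₁)`/`(hD₂)` being DISCHARGED by the section identity of the inflation section
  (`EtaleLevels.thetaEvaluation_resD_inclHd`), the standard-type normalisation by `PointedInversion.standard`.
* `EtaleLevels.thetaEvaluation_iotaLim_inclHd` / **`EtaleLevels.cor112_ii_thetaEvaluation_of_pair`** — with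
  `ρlim :=` abc-iut-w5-d072's `pairRhoLim` (the model pointed-inversion pair `(α, β)`, p416287), the input (a) `hι` is
  DISCHARGED as well (`ThetaEvaluationModelEvKummer` + `CohomologyAutKummer`: the inflation section carries the unit
  classes to the `Π_Ÿ`-level Kummer classes, which `(α, β)` fixes) from the structural facts `hψA`/`hαA` (`Ker(Π ↠ G_k)`
  acts trivially on `k̄`, `α` over `G_k`) and `hβ` (`β` trivial on `(l·Δ_Θ)`).
* **`EtaleLevels.cor112_ii_thetaEvaluation_units`** — the FULLY CONCRETE instance: the module of constants IS
  `ℚ̄_pˣ` with abc-iut-w4-d007's Galois action through `ε` (`EtaleThetaDataOfSettingGaloisUnits`, p41xxxx: `unitsAction`,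
  `isOpen_stabilizer_units`, `finiteIndex_stabilizer_units`), the retractions ARE `LevelRetraction.ofAugmentation` for
  `ε : Π^tp_{X̲̲} → G_{ℚ_p}` (with `hN`, `hq` discharged here, `hψA`/`hαA` discharged from `units_coe_smul`): `Cor112_ii`
  holds at the model given ONLY (i) the decomposition-group facts for `I.Dmu` (`hDq` `D ∩ Δ = 1`, `hlift`, `hemb`),
  (ii) `hα` "`α` lies over `G_k`" and `hβ` "`β` trivial on `(l·Δ_Θ)`" for the pointed-inversion pair, (iii) `hμ` (Kummer
  theory of MLF, FACT-level, GAP G-w4d043-1), (iv) the Prop. 2.2 (ii) translate inputs (R1)–(R3), (v) `hres`.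
  `EtaleLevels.cor112_ii_thetaEvaluation_units_H1` — the same with the translate inputs ON `H¹(Π_Ÿ(Π), (l·Δ_Θ)(Π))`
  in LITERALLY abc-iut-w4-d010's shapes (`hrev` for abc-iut-w5-d072's `pairRho`, `hfree`), transported to the limit
  through abc-iut-w5-d187's injectivity of `toLim ⊤` (`IotaInvariantThetaInftyModel`, input `hfix`: the cyclotome has no
  nontrivial element fixed by an open subgroup).
Typed ≠ discharged for (i)–(v).
-/

noncomputable section

namespace Literature.IUT.HodgeArakelov

open Literature.AnabelianGeometry.EtaleTheta Literature.AnabelianGeometry.SemiGraphs CohomologySystemOfContH1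
open scoped Literature.AnabelianGeometry.EtaleTheta

namespace EtaleLevels

variable {p : ℕ} [Fact p.Prime] {D : Literature.AnabelianGeometry.EtaleTheta.ThetaSetting p}
  {E : D.EtaleThetaData} {l : ℕ} (C : E.DoubleUnderline l)

/-! ### The inputs of the canonical retractions at the model -/

/-- **`Ker(Π^tp_{X̲̲} → G_{ℚ_p})` acts trivially on `(l·Δ_Θ)`** (the input `hN` of `LevelRetraction.ofAugmentation` at the
model): for `n ∈ Π^tp_{X̲̲}` with trivial image under the augmentation, conjugation by `n` fixes every element of
`(l·Δ_Θ) ≤ Δ_Θ` — "`Δ^Θ_X` is a central extension" ([EtTh] §1 p. 12; L2's root axiom `ker_thetaToEll_central`).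
[cite: MochizukiEtTh2009, §1 p.12] -/
theorem aug_ker_acts_trivially (n : EtaleThetaDataOfSetting.Pi C)
    (hn : (D.aug.toMonoidHom.comp C.Huu.subtype) n = 1) (a : D.lDeltaTheta l) :
    MulAut.conjNormal (EtaleThetaDataOfSetting.phi C n) a = a := by
  apply Subtype.ext
  rw [MulAut.conjNormal_apply]
  have hmem : D.toTheta (n : D.PiTemp) ∈ (D.aug.toMonoidHom.ker).map D.toTheta :=
    Subgroup.mem_map.mpr ⟨(n : D.PiTemp), MonoidHom.mem_ker.mpr hn, rfl⟩
  have h := D.ker_thetaToEll_central (a : D.GtpTheta) (D.lDeltaTheta_le l a.2) _ hmem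
  change D.toTheta (n : D.PiTemp) * (a : D.GtpTheta) * (D.toTheta (n : D.PiTemp))⁻¹ = a
  rw [← h, mul_inv_cancel_right]

/-- The augmentation restricted to `Π^tp_{X̲̲}` is continuous (the input `hq` of `LevelRetraction.ofAugmentation`).
[cite: MochizukiSemiAnbd2006, §6 p.69] -/
theorem continuous_augHuu :
    Continuous (D.aug.toMonoidHom.comp C.Huu.subtype : EtaleThetaDataOfSetting.Pi C →* _) :=
  D.aug.continuous.comp continuous_subtype_val

/-! ### Cor. 1.12 (ii) for the model datum -/

variable (hC : D.Compat) (hS : D.Sec2Hyps)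
  (hl : l.Prime) (hp2 : p ≠ 2) (hpl : p ≠ l) (hζ : ∃ ζ : D.K, IsPrimitiveRoot ζ (4 * l))
  (mods : ∀ M : ℕ+, D.CyclotomeMod l M)
  (f : contCocycles D.toTheta D.DeltaTheta C.GtpYdduu) (hf : f ∈ C.rootCocycles hC)
  (hmods : ∀ (M M' : ℕ+) (h : (M : ℕ) ∣ (M' : ℕ)) (x : D.lDeltaTheta l),
    MuN.red p M M' h ((mods M').red x) = (mods M).red x)
  (h15 : Literature.AnabelianGeometry.EtaleTheta.ThetaSetting.Prop15iii E hC) (L : C.CuspLabels)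
  (hZ : ∀ M : ℕ+, Nonempty (ModelCyclotomes.lDeltaQuot (C.rigidData (mods M) hC hS h15 L) ≃*
    Literature.IUT.HodgeTheaters.ZHat))
  (hcharY : EtaleThetaDataOfSetting.PiYddCharacteristic C)
  (hlim : Function.Bijective (rigidLimHom C hC hS hl hp2 hpl hζ mods f hf hmods h15 L hZ))
  (Env : EnvOfGroup (setting C hC hS hl hp2 hpl hζ mods f hf)
    (modelSystem C hC hS hl hp2 hpl hζ mods f hf hmods h15 L hZ).PiX)
  (I : PointedInversion Env (thetaEnvData C hC hS hl hp2 hpl hζ mods f hf hmods h15 L hZ hcharY hlim).D)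
  (R : LevelRetraction (EtaleThetaDataOfSetting.phi C) (D.lDeltaTheta l) (EtaleThetaDataOfSetting.PiYdd C) I.Dmu)
  {Aroot : Type} [CommGroup Aroot] [MulDistribMulAction (EtaleThetaDataOfSetting.Pi C) Aroot]
  [TopologicalSpace Aroot] [RootableBy Aroot ℕ]
  (c : CyclotomeCoefficients (EtaleThetaDataOfSetting.phi C) (D.lDeltaTheta l) Aroot)
  (hA : ∀ b : Aroot, IsOpen (MulAction.stabilizer (EtaleThetaDataOfSetting.Pi C) b :
    Set (EtaleThetaDataOfSetting.Pi C)))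
  (hfi : ∀ b : Aroot, (MulAction.stabilizer (EtaleThetaDataOfSetting.Pi C) b).FiniteIndex)
  (U : Subgroup Aroot)
  (ρlim : (EtaleThetaDataOfSetting.coh C).lim ≃+ (EtaleThetaDataOfSetting.coh C).lim)

/-- **[IUTchII] Cor. 1.12 (ii) for the MODEL theta-evaluation datum** `EtaleLevels.thetaEvaluation …` (over
abc-iut-w4-d030's `θ_env`-data of the natural system, abc-iut-L6-t1's REAL cohomology system, abc-iut-w4-d007's Kummer
map into the genuine limit, the inflation section): `Cor112_ii` — restriction to `D_{μ_-}` maps `{M^×_TM·∞θ(Π)}^ι` into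
`M^×_TM(Π)`, the inverse image of the torsion is `∞θ(Π)^ι`, and the splitting `(†μθ)(Π)` exists uniquely modulo torsion —
HOLDS given: `hι` (`ι` fixes the unit classes up to torsion: `ι_Ÿ` lies over `k`, Rmk. 1.4.1 (ii)), `hμ` (torsion
classes on `D_{μ_-}` are unit classes: Kummer theory of MLF, FACT-level), the Prop. 2.2 (ii) translate inputs `τ`
(with `τ 0 = I.etaStd`), `hdesc`, `hrev`, `hfree`, and `hres` (compatibility of `I.resDmu` with restriction on the
limit). The unit-class inputs `(hD₁)`/`(hD₂)` are discharged by the section identity `res_D ∘ inclHd = id` of the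
model datum and the standard-type normalisation by the field `PointedInversion.standard`.
[claim: Mochizuki2012, status: disputed] (IUTchII §1 Cor 1.12 (ii), kurims pp.57-58) -/
theorem cor112_ii_thetaEvaluation
    (hι : ∀ m ∈ (thetaEvaluation C hC hS hl hp2 hpl hζ mods f hf hmods h15 L hZ hcharY hlim Env I R c hA hfi U
        ρlim).MxTM,
      IsOfFinAddOrder
        ((thetaEvaluation C hC hS hl hp2 hpl hζ mods f hf hmods h15 L hZ hcharY hlim Env I R c hA hfi U ρlim).iotaLim
            ((thetaEvaluation C hC hS hl hp2 hpl hζ mods f hf hmods h15 L hZ hcharY hlim Env I R c hA hfi U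
              ρlim).inclHd m) -
          (thetaEvaluation C hC hS hl hp2 hpl hζ mods f hf hmods h15 L hZ hcharY hlim Env I R c hA hfi U
            ρlim).inclHd m))
    (hμ : ∀ y : h1Lim (EtaleThetaDataOfSetting.phi C) (D.lDeltaTheta l) I.Dmu ⊥, IsOfFinAddOrder y →
      y ∈ (thetaEvaluation C hC hS hl hp2 hpl hζ mods f hf hmods h15 L hZ hcharY hlim Env I R c hA hfi U ρlim).MxTM)
    (τ : ℤ → (EtaleThetaDataOfSetting.coh C).H1 ⊤) (hτ : τ 0 = I.etaStd)
    (hdesc : ∀ o ∈ EtaleThetaDataOfSetting.orbitOne C hC,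
      ∃ (n : ℤ) (c' : (EtaleThetaDataOfSetting.coh C).H1 ⊤), 2 • c' = 0 ∧ o = τ n + c')
    (hrev : ∀ n : ℤ, IsOfFinAddOrder (ρlim ((EtaleThetaDataOfSetting.coh C).toLim ⊤ (τ n)) -
      (EtaleThetaDataOfSetting.coh C).toLim ⊤ (τ (-n))))
    (hfree : ∀ m n : ℤ, IsOfFinAddOrder ((EtaleThetaDataOfSetting.coh C).toLim ⊤ (τ m) -
      (EtaleThetaDataOfSetting.coh C).toLim ⊤ (τ n)) → m = n)
    (hres : ∀ x : (EtaleThetaDataOfSetting.coh C).H1 ⊤, IsOfFinAddOrder (I.resDmu x) →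
      IsOfFinAddOrder (h1LimRestrict (EtaleThetaDataOfSetting.phi C) (D.lDeltaTheta l) I.Dmu_le ⊥
        ((EtaleThetaDataOfSetting.coh C).toLim ⊤ x))) :
    Literature.IUT.HodgeArakelov.Cor112_ii
      (thetaEvaluation C hC hS hl hp2 hpl hζ mods f hf hmods h15 L hZ hcharY hlim Env I R c hA hfi U ρlim) :=
  ThetaEvaluation.cor112_ii_of_section_of_pointedInversion
    (Ev := thetaEvaluation C hC hS hl hp2 hpl hζ mods f hf hmods h15 L hZ hcharY hlim Env I R c hA hfi U ρlim)
    (fun m _ =>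
      thetaEvaluation_resD_inclHd C hC hS hl hp2 hpl hζ mods f hf hmods h15 L hZ hcharY hlim Env I R c hA hfi U ρlim m)
    hι hμ τ hτ hdesc hrev hfree hres

/-! ### With `ρlim :=` the model pointed-inversion pair: `hι` discharged -/

variable (α : (EtaleThetaDataOfSetting.Pi C) ≃ₜ* (EtaleThetaDataOfSetting.Pi C)) (β : D.GtpTheta ≃ₜ* D.GtpTheta)
  (hφ : ∀ g, β (EtaleThetaDataOfSetting.phi C g) = EtaleThetaDataOfSetting.phi C (α g))
  (hAβ : ∀ a : D.GtpTheta, a ∈ D.lDeltaTheta l ↔ β a ∈ D.lDeltaTheta l)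
  (hH : ∀ x, x ∈ EtaleThetaDataOfSetting.PiYdd C ↔ α x ∈ EtaleThetaDataOfSetting.PiYdd C)

/-- **`ι` FIXES the unit classes of the model datum** when `iotaLim :=` abc-iut-w5-d072's `pairRhoLim` of an automorphism
pair `(α, β)` (the model pointed inversion): for `m ∈ M^×_TM(Π)`, `iotaLim (inclHd m) = inclHd m` — given that the
retractions and `α` respect the action on `k̄ˣ` (`hψA`, `hαA`: `Ker(Π ↠ G_k)` acts trivially, `α` lies over `G_k`; Rmk.
1.4.1 (ii) "`ι_Ÿ` of `Ÿ̲_k` lifting `ι_X̲̲`", over `k`) and `β` is trivial on the coefficients `(l·Δ_Θ)` (`hβ`). The input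
`(hι)` of Cor. 1.12 (ii) on the nose. [claim: Mochizuki2012, status: disputed] (IUTchII §1 Cor 1.12 (ii), kurims p.57) -/
theorem thetaEvaluation_iotaLim_inclHd
    (hψA : ∀ i (k : ↥(EtaleThetaDataOfSetting.PiYdd C ⊓ (R.lift i).K)) (b : Aroot),
      ((R.ψ i k : ↥(I.Dmu ⊓ i.K)) : EtaleThetaDataOfSetting.Pi C) • b = (k : EtaleThetaDataOfSetting.Pi C) • b)
    (hαA : ∀ (x : EtaleThetaDataOfSetting.Pi C) (b : Aroot), α.symm x • b = x • b)
    (hβ : ∀ a : D.GtpTheta, a ∈ D.lDeltaTheta l → β a = a)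
    (m) (hm : m ∈ (thetaEvaluation C hC hS hl hp2 hpl hζ mods f hf hmods h15 L hZ hcharY hlim Env I R c hA hfi U
        (EtaleThetaDataOfSetting.pairRhoLim C α β hφ hAβ hH)).MxTM) :
    (thetaEvaluation C hC hS hl hp2 hpl hζ mods f hf hmods h15 L hZ hcharY hlim Env I R c hA hfi U
        (EtaleThetaDataOfSetting.pairRhoLim C α β hφ hAβ hH)).iotaLim
      ((thetaEvaluation C hC hS hl hp2 hpl hζ mods f hf hmods h15 L hZ hcharY hlim Env I R c hA hfi U
        (EtaleThetaDataOfSetting.pairRhoLim C α β hφ hAβ hH)).inclHd m) =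
      (thetaEvaluation C hC hS hl hp2 hpl hζ mods f hf hmods h15 L hZ hcharY hlim Env I R c hA hfi U
        (EtaleThetaDataOfSetting.pairRhoLim C α β hφ hAβ hH)).inclHd m := by
  -- the unit class `inclHd m` is a `Π_Ÿ`-level Kummer class of a unit
  have himg : R.h1LimSection m ∈
      (AddSubgroup.toSubgroup.symm
        (U.map (h1LimKummer (EtaleThetaDataOfSetting.phi C) (D.lDeltaTheta l) (EtaleThetaDataOfSetting.PiYdd C)
          c hA hfi)) : Set (h1Lim (EtaleThetaDataOfSetting.phi C) (D.lDeltaTheta l)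
            (EtaleThetaDataOfSetting.PiYdd C) ⊥)) := by
    rw [← R.h1LimSection_image_kummer c hA hfi hψA U]
    exact ⟨m, hm, rfl⟩
  exact h1LimAutEquiv_eq_self_of_mem_kummer (EtaleThetaDataOfSetting.phi C) (D.lDeltaTheta l)
    (EtaleThetaDataOfSetting.PiYdd C) c α β hφ hAβ hH hA hfi hαA hβ U himg

/-- **[IUTchII] Cor. 1.12 (ii) for the MODEL datum with the model pointed-inversion pair** (`iotaLim := pairRhoLim`):
as `cor112_ii_thetaEvaluation`, with the input `(hι)` DISCHARGED (`thetaEvaluation_iotaLim_inclHd`). Remaining inputs: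
`hμ` (Kummer theory of MLF, FACT-level), the Prop. 2.2 (ii) translate inputs `τ`/`hτ`/`hdesc`/`hrev`/`hfree`
((R1)–(R3) of G-w4d010-2), `hres`, and the structural `hψA`/`hαA`/`hβ`.
[claim: Mochizuki2012, status: disputed] (IUTchII §1 Cor 1.12 (ii), kurims pp.57-58) -/
theorem cor112_ii_thetaEvaluation_of_pair
    (hψA : ∀ i (k : ↥(EtaleThetaDataOfSetting.PiYdd C ⊓ (R.lift i).K)) (b : Aroot),
      ((R.ψ i k : ↥(I.Dmu ⊓ i.K)) : EtaleThetaDataOfSetting.Pi C) • b = (k : EtaleThetaDataOfSetting.Pi C) • b)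
    (hαA : ∀ (x : EtaleThetaDataOfSetting.Pi C) (b : Aroot), α.symm x • b = x • b)
    (hβ : ∀ a : D.GtpTheta, a ∈ D.lDeltaTheta l → β a = a)
    (hμ : ∀ y : h1Lim (EtaleThetaDataOfSetting.phi C) (D.lDeltaTheta l) I.Dmu ⊥, IsOfFinAddOrder y →
      y ∈ (thetaEvaluation C hC hS hl hp2 hpl hζ mods f hf hmods h15 L hZ hcharY hlim Env I R c hA hfi U
        (EtaleThetaDataOfSetting.pairRhoLim C α β hφ hAβ hH)).MxTM)
    (τ : ℤ → (EtaleThetaDataOfSetting.coh C).H1 ⊤) (hτ : τ 0 = I.etaStd)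
    (hdesc : ∀ o ∈ EtaleThetaDataOfSetting.orbitOne C hC,
      ∃ (n : ℤ) (c' : (EtaleThetaDataOfSetting.coh C).H1 ⊤), 2 • c' = 0 ∧ o = τ n + c')
    (hrev : ∀ n : ℤ, IsOfFinAddOrder (EtaleThetaDataOfSetting.pairRhoLim C α β hφ hAβ hH
      ((EtaleThetaDataOfSetting.coh C).toLim ⊤ (τ n)) - (EtaleThetaDataOfSetting.coh C).toLim ⊤ (τ (-n))))
    (hfree : ∀ m n : ℤ, IsOfFinAddOrder ((EtaleThetaDataOfSetting.coh C).toLim ⊤ (τ m) -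
      (EtaleThetaDataOfSetting.coh C).toLim ⊤ (τ n)) → m = n)
    (hres : ∀ x : (EtaleThetaDataOfSetting.coh C).H1 ⊤, IsOfFinAddOrder (I.resDmu x) →
      IsOfFinAddOrder (h1LimRestrict (EtaleThetaDataOfSetting.phi C) (D.lDeltaTheta l) I.Dmu_le ⊥
        ((EtaleThetaDataOfSetting.coh C).toLim ⊤ x))) :
    Literature.IUT.HodgeArakelov.Cor112_ii
      (thetaEvaluation C hC hS hl hp2 hpl hζ mods f hf hmods h15 L hZ hcharY hlim Env I R c hA hfi U
        (EtaleThetaDataOfSetting.pairRhoLim C α β hφ hAβ hH)) := by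
  refine cor112_ii_thetaEvaluation C hC hS hl hp2 hpl hζ mods f hf hmods h15 L hZ hcharY hlim Env I R c hA hfi U
    (EtaleThetaDataOfSetting.pairRhoLim C α β hφ hAβ hH) (fun m hm => ?_) hμ τ hτ hdesc hrev hfree hres
  rw [thetaEvaluation_iotaLim_inclHd C hC hS hl hp2 hpl hζ mods f hf hmods h15 L hZ hcharY hlim Env I R c hA hfi U
    α β hφ hAβ hH hψA hαA hβ m hm, sub_self]
  exact IsOfFinAddOrder.zero

/-! ### The fully concrete instance: constants `ℚ̄_pˣ` with the Galois action through `ε`, canonical retractions -/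

/-- `Π^tp_{X̲̲}` acts on `ℚ̄_pˣ` THROUGH `ε` (abc-iut-w4-d007's `unitsAction`): elements with the same image under `ε` act
identically. [cite: Mochizuki2012, Prop 3.1 (ii) p.88] -/
theorem smul_units_eq_of_aug_eq {g h : EtaleThetaDataOfSetting.Pi C}
    (hgh : EtaleThetaDataOfSetting.aug C g = EtaleThetaDataOfSetting.aug C h) (u : (PadicAlgCl p)ˣ) :
    g • u = h • u :=
  Units.ext (by rw [EtaleThetaDataOfSetting.units_coe_smul, EtaleThetaDataOfSetting.units_coe_smul, hgh])

variable (hDq : ∀ d ∈ I.Dmu, EtaleThetaDataOfSetting.aug C d = 1 → d = 1)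
  (hlift : ∀ K : Subgroup (EtaleThetaDataOfSetting.Pi C), K.FiniteIndex → IsOpen (K : Set (EtaleThetaDataOfSetting.Pi C)) →
    (liftSubgroup (EtaleThetaDataOfSetting.aug C) I.Dmu K).FiniteIndex ∧
      IsOpen (liftSubgroup (EtaleThetaDataOfSetting.aug C) I.Dmu K : Set (EtaleThetaDataOfSetting.Pi C)))
  (hemb : ∀ K : Subgroup (EtaleThetaDataOfSetting.Pi C),
    Topology.IsEmbedding fun d : ↥(I.Dmu ⊓ K) => EtaleThetaDataOfSetting.aug C d.1)
  (cU : CyclotomeCoefficients (EtaleThetaDataOfSetting.phi C) (D.lDeltaTheta l) (PadicAlgCl p)ˣ)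
  (Uu : Subgroup (PadicAlgCl p)ˣ)

/-- **[IUTchII] Cor. 1.12 (ii) at the model — the fully concrete instance.** `Π := Π^tp_{X̲̲}`, coefficients `(l·Δ_Θ)`
(REAL continuous cohomology), constants `ℚ̄_pˣ ⊇ U` acted on through `ε`, the theta-evaluation datum
`EtaleLevels.thetaEvaluation` with `inclHd :=` the inflation section of the CANONICAL retractions
`LevelRetraction.ofAugmentation ε D_{μ_-}` and `iotaLim :=` the model pointed-inversion pair `pairRhoLim (α, β)`:
`Cor112_ii` holds given ONLY (i) the decomposition-group facts for `D_{μ_-} = I.Dmu` (`hDq`: `D ∩ Δ = 1`; `hlift`: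
lifted levels finite-index open; `hemb`: `ε|_{D ∩ K}` a topological embedding), (ii) `hα`: `α` lies over `G_k` and `hβ`:
`β` trivial on `(l·Δ_Θ)` (Rmk. 1.4.1 (ii)), (iii) `hμ`: torsion classes on `D_{μ_-}` are unit classes (Kummer theory of
MLF; GAP G-w4d043-1), (iv) the Prop. 2.2 (ii) translate inputs `τ`/`hτ`/`hdesc`/`hrev`/`hfree` ((R1)–(R3) of
G-w4d010-2), (v) `hres`. The inputs `hD₁`/`hD₂` (inflation section), `hι` (the pair fixes Kummer classes of constants),
`hθ₀` (translates + `PointedInversion.standard`), `hN`/`hq`/`hψA`/`hαA` (structure of `ε`) are DISCHARGED.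
[claim: Mochizuki2012, status: disputed] (IUTchII §1 Cor 1.12 (ii), kurims pp.56-58) -/
theorem cor112_ii_thetaEvaluation_units
    (hα : ∀ x, EtaleThetaDataOfSetting.aug C (α x) = EtaleThetaDataOfSetting.aug C x)
    (hβ : ∀ a : D.GtpTheta, a ∈ D.lDeltaTheta l → β a = a)
    (hμ : ∀ y : h1Lim (EtaleThetaDataOfSetting.phi C) (D.lDeltaTheta l) I.Dmu ⊥, IsOfFinAddOrder y →
      y ∈ (thetaEvaluation C hC hS hl hp2 hpl hζ mods f hf hmods h15 L hZ hcharY hlim Env I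
        (LevelRetraction.ofAugmentation (EtaleThetaDataOfSetting.phi C) (D.lDeltaTheta l)
          (EtaleThetaDataOfSetting.aug C) I.Dmu hDq (EtaleThetaDataOfSetting.PiYdd C)
          (EtaleThetaDataOfSetting.continuous_aug C) (aug_ker_acts_trivially C) hlift hemb)
        cU (EtaleThetaDataOfSetting.isOpen_stabilizer_units C) (EtaleThetaDataOfSetting.finiteIndex_stabilizer_units C)
        Uu (EtaleThetaDataOfSetting.pairRhoLim C α β hφ hAβ hH)).MxTM)
    (τ : ℤ → (EtaleThetaDataOfSetting.coh C).H1 ⊤) (hτ : τ 0 = I.etaStd)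
    (hdesc : ∀ o ∈ EtaleThetaDataOfSetting.orbitOne C hC,
      ∃ (n : ℤ) (c' : (EtaleThetaDataOfSetting.coh C).H1 ⊤), 2 • c' = 0 ∧ o = τ n + c')
    (hrev : ∀ n : ℤ, IsOfFinAddOrder (EtaleThetaDataOfSetting.pairRhoLim C α β hφ hAβ hH
      ((EtaleThetaDataOfSetting.coh C).toLim ⊤ (τ n)) - (EtaleThetaDataOfSetting.coh C).toLim ⊤ (τ (-n))))
    (hfree : ∀ m n : ℤ, IsOfFinAddOrder ((EtaleThetaDataOfSetting.coh C).toLim ⊤ (τ m) -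
      (EtaleThetaDataOfSetting.coh C).toLim ⊤ (τ n)) → m = n)
    (hres : ∀ x : (EtaleThetaDataOfSetting.coh C).H1 ⊤, IsOfFinAddOrder (I.resDmu x) →
      IsOfFinAddOrder (h1LimRestrict (EtaleThetaDataOfSetting.phi C) (D.lDeltaTheta l) I.Dmu_le ⊥
        ((EtaleThetaDataOfSetting.coh C).toLim ⊤ x))) :
    Literature.IUT.HodgeArakelov.Cor112_ii
      (thetaEvaluation C hC hS hl hp2 hpl hζ mods f hf hmods h15 L hZ hcharY hlim Env I
        (LevelRetraction.ofAugmentation (EtaleThetaDataOfSetting.phi C) (D.lDeltaTheta l)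
          (EtaleThetaDataOfSetting.aug C) I.Dmu hDq (EtaleThetaDataOfSetting.PiYdd C)
          (EtaleThetaDataOfSetting.continuous_aug C) (aug_ker_acts_trivially C) hlift hemb)
        cU (EtaleThetaDataOfSetting.isOpen_stabilizer_units C) (EtaleThetaDataOfSetting.finiteIndex_stabilizer_units C)
        Uu (EtaleThetaDataOfSetting.pairRhoLim C α β hφ hAβ hH)) := by
  refine cor112_ii_thetaEvaluation_of_pair C hC hS hl hp2 hpl hζ mods f hf hmods h15 L hZ hcharY hlim Env I _ cU _ _
    Uu α β hφ hAβ hH (fun i k u => ?_) (fun x u => ?_) hβ hμ τ hτ hdesc hrev hfree hres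
  · -- `hψA`: the retraction preserves `ε`, and the action factors through `ε`
    exact smul_units_eq_of_aug_eq C
      (q_retract hDq (EtaleThetaDataOfSetting.PiYdd C) i.K k) u
  · -- `hαA`: `α` lies over `G_k`
    refine smul_units_eq_of_aug_eq C ?_ u
    have h := hα (α.symm x)
    rw [ContinuousMulEquiv.apply_symm_apply] at h
    exact h.symm

/-- **[IUTchII] Cor. 1.12 (ii) at the model, translate inputs on `H¹`** (abc-iut-w4-d010's binder shapes for node
IUTchII:Prop2.2(ii) verbatim: `hrev` for abc-iut-w5-d072's `pairRho`, `hfree` on `H¹(Π_Ÿ(Π), (l·Δ_Θ)(Π))`), transported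
to the limit by the injectivity of `toLim ⊤` (abc-iut-w5-d187's `toLim_top_injective_of_forall_fixed_eq_one`, input
`hfix`: no nontrivial element of `(l·Δ_Θ)` is fixed by `Π_Ÿ(Π) ∩ K'` for a finite-index `K'` — the cyclotomic character is
nontrivial on open subgroups). Otherwise as `cor112_ii_thetaEvaluation_units`.
[claim: Mochizuki2012, status: disputed] (IUTchII §1 Cor 1.12 (ii), kurims pp.56-58) -/
theorem cor112_ii_thetaEvaluation_units_H1
    (hα : ∀ x, EtaleThetaDataOfSetting.aug C (α x) = EtaleThetaDataOfSetting.aug C x)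
    (hβ : ∀ a : D.GtpTheta, a ∈ D.lDeltaTheta l → β a = a)
    (hfix : ∀ K' : Subgroup (EtaleThetaDataOfSetting.Pi C), K'.FiniteIndex →
      ∀ a : D.lDeltaTheta l, (∀ n : EtaleThetaDataOfSetting.Pi C, n ∈ EtaleThetaDataOfSetting.PiYdd C ⊓ K' →
        MulAut.conjNormal (EtaleThetaDataOfSetting.phi C n) a = a) → a = 1)
    (hμ : ∀ y : h1Lim (EtaleThetaDataOfSetting.phi C) (D.lDeltaTheta l) I.Dmu ⊥, IsOfFinAddOrder y →
      y ∈ (thetaEvaluation C hC hS hl hp2 hpl hζ mods f hf hmods h15 L hZ hcharY hlim Env I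
        (LevelRetraction.ofAugmentation (EtaleThetaDataOfSetting.phi C) (D.lDeltaTheta l)
          (EtaleThetaDataOfSetting.aug C) I.Dmu hDq (EtaleThetaDataOfSetting.PiYdd C)
          (EtaleThetaDataOfSetting.continuous_aug C) (aug_ker_acts_trivially C) hlift hemb)
        cU (EtaleThetaDataOfSetting.isOpen_stabilizer_units C) (EtaleThetaDataOfSetting.finiteIndex_stabilizer_units C)
        Uu (EtaleThetaDataOfSetting.pairRhoLim C α β hφ hAβ hH)).MxTM)
    (τ : ℤ → (EtaleThetaDataOfSetting.coh C).H1 ⊤) (hτ : τ 0 = I.etaStd)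
    (hdesc : ∀ o ∈ EtaleThetaDataOfSetting.orbitOne C hC,
      ∃ (n : ℤ) (c' : (EtaleThetaDataOfSetting.coh C).H1 ⊤), 2 • c' = 0 ∧ o = τ n + c')
    (hrev : ∀ n : ℤ, IsOfFinAddOrder (EtaleThetaDataOfSetting.pairRho C α β hφ hAβ hH (τ n) - τ (-n)))
    (hfree : ∀ m n : ℤ, IsOfFinAddOrder (τ m - τ n) → m = n)
    (hres : ∀ x : (EtaleThetaDataOfSetting.coh C).H1 ⊤, IsOfFinAddOrder (I.resDmu x) →
      IsOfFinAddOrder (h1LimRestrict (EtaleThetaDataOfSetting.phi C) (D.lDeltaTheta l) I.Dmu_le ⊥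
        ((EtaleThetaDataOfSetting.coh C).toLim ⊤ x))) :
    Literature.IUT.HodgeArakelov.Cor112_ii
      (thetaEvaluation C hC hS hl hp2 hpl hζ mods f hf hmods h15 L hZ hcharY hlim Env I
        (LevelRetraction.ofAugmentation (EtaleThetaDataOfSetting.phi C) (D.lDeltaTheta l)
          (EtaleThetaDataOfSetting.aug C) I.Dmu hDq (EtaleThetaDataOfSetting.PiYdd C)
          (EtaleThetaDataOfSetting.continuous_aug C) (aug_ker_acts_trivially C) hlift hemb)
        cU (EtaleThetaDataOfSetting.isOpen_stabilizer_units C) (EtaleThetaDataOfSetting.finiteIndex_stabilizer_units C)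
        Uu (EtaleThetaDataOfSetting.pairRhoLim C α β hφ hAβ hH)) := by
  -- `toLim ⊤` is injective (w5-d187), hence reflects torsion
  have hker : ∀ x : (EtaleThetaDataOfSetting.coh C).H1 ⊤,
      IsOfFinAddOrder ((EtaleThetaDataOfSetting.coh C).toLim ⊤ x) → IsOfFinAddOrder x := by
    intro x hx
    obtain ⟨n, hn, hnx⟩ := isOfFinAddOrder_iff_nsmul_eq_zero.mp hx
    refine isOfFinAddOrder_iff_nsmul_eq_zero.mpr ⟨n, hn, ?_⟩
    apply toLim_top_injective_of_forall_fixed_eq_one (EtaleThetaDataOfSetting.phi C) (D.lDeltaTheta l)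
      (EtaleThetaDataOfSetting.PiYdd C) hfix
    rw [map_nsmul, hnx, map_zero]
  have hT := ThetaEvaluation.translates_toLim_of_H1
    (Ev := thetaEvaluation C hC hS hl hp2 hpl hζ mods f hf hmods h15 L hZ hcharY hlim Env I
        (LevelRetraction.ofAugmentation (EtaleThetaDataOfSetting.phi C) (D.lDeltaTheta l)
          (EtaleThetaDataOfSetting.aug C) I.Dmu hDq (EtaleThetaDataOfSetting.PiYdd C)
          (EtaleThetaDataOfSetting.continuous_aug C) (aug_ker_acts_trivially C) hlift hemb)
        cU (EtaleThetaDataOfSetting.isOpen_stabilizer_units C) (EtaleThetaDataOfSetting.finiteIndex_stabilizer_units C)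
        Uu (EtaleThetaDataOfSetting.pairRhoLim C α β hφ hAβ hH))
    (EtaleThetaDataOfSetting.pairRho C α β hφ hAβ hH) (EtaleThetaDataOfSetting.toLim_pairRho C α β hφ hAβ hH)
    hker τ hrev hfree
  exact cor112_ii_thetaEvaluation_units C hC hS hl hp2 hpl hζ mods f hf hmods h15 L hZ hcharY hlim Env I α β hφ hAβ hH
    hDq hlift hemb cU Uu hα hβ hμ τ hτ hdesc hT.1 hT.2 hres

end EtaleLevels

end Literature.IUT.HodgeArakelov
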